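import Summits.QuantumFields.YangMills.Theorems.UnitScaleTiltProp7SectET3DeltaOneT3
import Summits.QuantumFields.YangMills.Theorems.UnitScaleTiltProp7SectET3LandauRowsT3
import HarnessLib

/-!
# Route `UnitScaleTilt`, crux «MinimiserStabilityRegPr» (stmt-QuantumFields-19200, stub EX) ∕ (O″χ) B0 (stmt-QuantumFields-20520), node N06(d = 3), route (α) —
# LAYER 0, ROWS OF BRICK L0b PART 3 (def-free sibling of `UnitScaleTiltProp7SectET3DeltaOneT3`): **THE SIX DISPLAYED EX IDENTITY ROWS FOR PRINT'S `G₁`∕`H₁`∕`𝔊` PROPER — FOR EVERY J-TERM `T_J`** —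
# `h129` `Q(ιH₁f B) = η⁻¹B`, `h129L` `R_SD*(ιH₁f B) = 0`, `h102` `Q(ι𝒢f f) = 0`, `h102L` `R_SD*(ι𝒢f f) = 0`, (45)₁ `Q(HY) = Y`, (45)₂ `R_SD*(HY) = 0`, and both halves of (3.124) for `G₁`, modulo the classes
# `PosOnto … (DeltaOne TJ) U₀` ([B9] Thm 3.11 for `G₁`) and `PosPrime` only — because `Δ₁ = Pᵀ(Δ^η + T_J)P` kills, and has range orthogonal to, `D_{U₀}N_S(U₀)` (`P(Dλ) = 0`)

Cell `ym-inputs` (desk `pub/ym-inputs`, INPUT-LIST.md v6 §4 row p01; memo `pub/ym-inputs/DEFINER-MEMO-T3.md` §2 L0e).  THEOREMS ONLY (0 `def`, 0 `sorry`); `--supports stmt-QuantumFields-20520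
--as helper`; count-neutral.  YM₃ on T³ is ladder rung R3, NOT the Clay problem; nothing here is a claim about a stub, a crux, d = 4 or the mass gap.

WHAT IS PROVED (member `F`, `h : n ≤ K`, `c₀ cB a`, slot `TJ`, background `U₀`; `hp : PosOnto … (DeltaOne … TJ) U₀`, `hq : PosPrime … U₀`): `DeltaOne_DL2_of_mem_NS`, `DeltaOne_kills_NS`,
`inner_DL2_DeltaOne_eq_zero` (the two hypotheses `hΔ`, `hΔ'` of the (3.124) rows DISCHARGED for `Δ₁`, any `T_J`); (3.124): `Qk_G1pi_DL2_RS` (`QG₁DR_S = 0`), `RS_DstarL2_G1pi_adjoint` (`R_SD*G₁Q† = 0`);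
`Qk_frakG1pi` («Q𝔊 = 0»), `RS_DstarL2_frakG1pi` («RD*𝔊 = 0»), `RS_DstarL2_H1pi` («RD*H₁B = 0»); and on the route carriers, in the EX binders' currency: ★`QTwS_HfOne` ((45)₁), ★`landauS_HfOne` ((45)₂),
★`QTwS_iota_H1fOne` (`h129`), ★`landauS_iota_H1fOne` (`h129L`), ★`QTwS_iota_frakGfOne` (`h102`), ★`landauS_iota_frakGfOne` (`h102L`).
HONEST SCOPE.  Three-line instances of the `Δx`-generic rows of bricks L0d∕L0e (✓`QTwS_Hf`, ✓`QTwS_iota_H1f`, ✓`QTwS_iota_frakGfR`, ✓`Qk_GT_DL2_RS`, ✓`RS_DstarL2_GT_adjoint`, ✓`RS_DstarL2_HT`,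
✓`RS_DstarL2_frakGT`); finite-dimensional algebra on the displayed classes; no positivity or smallness proved; nothing of print asserted.

References: T. Bałaban, CMP **99** (1985) 389–434 [Balaban1985BackgroundPropagators] ((3.119) p.419, (3.124)–(3.126) p.420, (3.127)–(3.129) p.421, (3.147) p.425); CMP **102** (1985) 277–309
[Balaban1985Variational] ((45) p.285, (102)–(103) p.293, p.294, (129) p.297).
-/

set_option autoImplicit false

noncomputable section

open scoped InnerProductSpace ComplexConjugate Matrix.Norms.L2Operator

namespace Summit.QuantumFields.YangMills.Theorems.Prop7SectET3DeltaOne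

open Literature.MathematicalPhysics.QuantumFieldTheory.Balaban1983to89
open Literature.MathematicalPhysics.QuantumFieldTheory.Balaban1983to89.T3ContinuumYM3Torus
open T3SectALandauChart (eta)
open B9SectCLatticeCarrier (Bond)
open B9Eq311L2Pairing (WL2)
open B11Eq115Space (NegSize Space115 JetSup NegSup)
open B11Eq103H1Complex (SiteL2K BondL2K funEquiv)
open Summit.QuantumFields.YangMills.Theorems.Prop7SectET3Transport (periodsT3 bondEquiv bgOfCfg)
open Summit.QuantumFields.YangMills.Theorems.Prop7SectET3HilbertLetters (W₂ frobEquiv toL2 toL2B QL2 DL2 DstarL2)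
open Summit.QuantumFields.YangMills.Theorems.Prop7SectET3GaugeProjector (NS RS)
open Summit.QuantumFields.YangMills.Theorems.Prop7SymAvgTwSym (QTwS)
open Summit.QuantumFields.YangMills.Theorems.Prop7SectET3CurvedPropagators
open Summit.QuantumFields.YangMills.Theorems.Prop7SectET3WilsonHessian (DeltaEta)
open Summit.QuantumFields.YangMills.Theorems.Prop7SectET3DeltaPi (gaugeCorr PosPrime gaugeCorr_DL2_of_mem_NS RS_DstarL2_GT_adjoint RS_DstarL2_HT RS_DstarL2_frakGT)

variable {F : T3Family} {n K : ℕ} {h : n ≤ K} {c₀ cB a : ℝ} [Fact (0 < c₀)] [Fact (0 < cB)]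
  {TJ : GaugeField (F.P K) 0 (Matrix.specialUnitaryGroup (Fin 2) ℂ) → (BondL2K ℂ 3 (periodsT3 F K) c₀ W₂ →ₗ[ℂ] BondL2K ℂ 3 (periodsT3 F K) c₀ W₂)}

/-! ## §1 `Δ₁` kills, and has range orthogonal to, the residual pure gauges -/

/-- **`Δ₁(D_{U₀}λ) = 0` FOR `λ ∈ N_S(U₀)`** (any `T_J`): `P(Dλ) = 0`. [cite: Balaban1985BackgroundPropagators, (3.119) p.419, (3.128) p.421] -/
theorem DeltaOne_DL2_of_mem_NS {U₀ : GaugeField (F.P K) 0 (Matrix.specialUnitaryGroup (Fin 2) ℂ)} (hq : PosPrime F n K h c₀ cB a U₀)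
    {l : SiteL2K ℂ 3 (periodsT3 F K) c₀ W₂} (hl : l ∈ NS F n K h c₀ cB U₀) : DeltaOne F n K h c₀ cB a TJ U₀ (DL2 F n K c₀ U₀ l) = 0 := by
  rw [DeltaOne_apply, gaugeCorr_DL2_of_mem_NS hq hl, map_zero, map_zero, add_zero, map_zero]

/-- **THE HYPOTHESIS `hΔ` OF THE (3.124) ROWS, DISCHARGED FOR `Δx := DeltaOne TJ`.** [cite: Balaban1985BackgroundPropagators, (3.124) p.420, (3.128) p.421] -/
theorem DeltaOne_kills_NS {U₀ : GaugeField (F.P K) 0 (Matrix.specialUnitaryGroup (Fin 2) ℂ)} (hq : PosPrime F n K h c₀ cB a U₀) :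
    ∀ l ∈ NS F n K h c₀ cB U₀, DeltaOne F n K h c₀ cB a TJ U₀ (DL2 F n K c₀ U₀ l) = 0 :=
  fun _ hl => DeltaOne_DL2_of_mem_NS hq hl

/-- **THE HYPOTHESIS `hΔ'` OF THE LANDAU ROWS, DISCHARGED FOR `Δx := DeltaOne TJ`: `⟪Dλ, Δ₁w⟫ = ⟪P(Dλ), …⟫ = 0`.** [cite: Balaban1985BackgroundPropagators, (3.119) p.419, (3.128) p.421] -/
theorem inner_DL2_DeltaOne_eq_zero {U₀ : GaugeField (F.P K) 0 (Matrix.specialUnitaryGroup (Fin 2) ℂ)} (hq : PosPrime F n K h c₀ cB a U₀) :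
    ∀ l ∈ NS F n K h c₀ cB U₀, ∀ w, ⟪DL2 F n K c₀ U₀ l, DeltaOne F n K h c₀ cB a TJ U₀ w⟫_ℂ = 0 := by
  intro l hl w
  rw [inner_DeltaOne, gaugeCorr_DL2_of_mem_NS hq hl, inner_zero_left, inner_zero_left, add_zero]

/-! ## §2 (3.124) for `G₁`, «`Q𝔊 = 0`», «`RD*𝔊 = 0`», «`RD*H₁B = 0`» at the Hilbert level -/

/-- ★ **(3.124)₂ FOR `G₁`: `Q_kG₁DR_S = 0`.** [cite: Balaban1985BackgroundPropagators, (3.124) p.420, (3.128) p.421] -/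
theorem Qk_G1pi_DL2_RS {U₀ : GaugeField (F.P K) 0 (Matrix.specialUnitaryGroup (Fin 2) ℂ)} (hp : PosOnto F n K h c₀ cB a (DeltaOne F n K h c₀ cB a TJ) U₀)
    (hq : PosPrime F n K h c₀ cB a U₀) (s : SiteL2K ℂ 3 (periodsT3 F K) c₀ W₂) :
    Qk F n K h c₀ cB U₀ (G1pi F n K h c₀ cB a TJ U₀ (DL2 F n K c₀ U₀ (RS F n K h c₀ cB U₀ s))) = 0 :=
  Qk_GT_DL2_RS hp (DeltaOne_kills_NS hq) s

/-- ★ **(3.124)₁ FOR `G₁`: `R_SD*G₁Q_k† = 0`.** [cite: Balaban1985BackgroundPropagators, (3.124) p.420, (3.128) p.421] -/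
theorem RS_DstarL2_G1pi_adjoint {U₀ : GaugeField (F.P K) 0 (Matrix.specialUnitaryGroup (Fin 2) ℂ)} (hp : PosOnto F n K h c₀ cB a (DeltaOne F n K h c₀ cB a TJ) U₀)
    (hq : PosPrime F n K h c₀ cB a U₀) (y : WL2 ℂ (fun _ : PBond (F.P n) 0 => cB) W₂) :
    RS F n K h c₀ cB U₀ (DstarL2 F n K c₀ U₀ (G1pi F n K h c₀ cB a TJ U₀ (LinearMap.adjoint (Qk F n K h c₀ cB U₀) y))) = 0 :=
  RS_DstarL2_GT_adjoint hp (inner_DL2_DeltaOne_eq_zero hq) y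

/-- ★ **«`Q𝔊 = 0`» FOR `𝔊 = G₁𝔓*`.** [cite: Balaban1985Variational, p.294, (102) p.293; Balaban1985BackgroundPropagators, (3.147) p.425] -/
theorem Qk_frakG1pi {U₀ : GaugeField (F.P K) 0 (Matrix.specialUnitaryGroup (Fin 2) ℂ)} (hp : PosOnto F n K h c₀ cB a (DeltaOne F n K h c₀ cB a TJ) U₀)
    (hq : PosPrime F n K h c₀ cB a U₀) (x : BondL2K ℂ 3 (periodsT3 F K) c₀ W₂) :
    Qk F n K h c₀ cB U₀ (frakG1pi F n K h c₀ cB a TJ U₀ x) = 0 :=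
  Qk_frakGT hp (DeltaOne_kills_NS hq) x

/-- ★ **«`RD*𝔊 = 0`» FOR `𝔊 = G₁𝔓*`.** [cite: Balaban1985Variational, p.294, (102) p.293; Balaban1985BackgroundPropagators, (3.124) p.420] -/
theorem RS_DstarL2_frakG1pi {U₀ : GaugeField (F.P K) 0 (Matrix.specialUnitaryGroup (Fin 2) ℂ)} (hp : PosOnto F n K h c₀ cB a (DeltaOne F n K h c₀ cB a TJ) U₀)
    (hq : PosPrime F n K h c₀ cB a U₀) (x : BondL2K ℂ 3 (periodsT3 F K) c₀ W₂) :
    RS F n K h c₀ cB U₀ (DstarL2 F n K c₀ U₀ (frakG1pi F n K h c₀ cB a TJ U₀ x)) = 0 :=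
  RS_DstarL2_frakGT hp (DeltaOne_kills_NS hq) (inner_DL2_DeltaOne_eq_zero hq) x

/-- ★ **«`RD*H₁B = 0`» FOR `H₁ = G₁Q*(QG₁Q*)⁻¹`.** [cite: Balaban1985Variational, (45) p.285; Balaban1985BackgroundPropagators, (3.129) p.421, (3.110) p.417] -/
theorem RS_DstarL2_H1pi {U₀ : GaugeField (F.P K) 0 (Matrix.specialUnitaryGroup (Fin 2) ℂ)} (hp : PosOnto F n K h c₀ cB a (DeltaOne F n K h c₀ cB a TJ) U₀)
    (hq : PosPrime F n K h c₀ cB a U₀) (B : WL2 ℂ (fun _ : PBond (F.P n) 0 => cB) W₂) :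
    RS F n K h c₀ cB U₀ (DstarL2 F n K c₀ U₀ (H1pi F n K h c₀ cB a TJ U₀ B)) = 0 :=
  RS_DstarL2_HT hp (inner_DL2_DeltaOne_eq_zero hq) B

/-! ## §3 The six displayed EX identity rows for the letters of `G₁`∕`H₁`∕`𝔊`, on the route carriers -/

/-- ★ **(45)₁ FOR THE `h46tw`-TYPE READER OF `H₁`: `QTwS U₀ (HfOne Y) = Y`.** [cite: Balaban1985Variational, (45) p.285; Balaban1985BackgroundPropagators, (3.129) p.421] -/
theorem QTwS_HfOne {U₀ : GaugeField (F.P K) 0 (Matrix.specialUnitaryGroup (Fin 2) ℂ)} (hp : PosOnto F n K h c₀ cB a (DeltaOne F n K h c₀ cB a TJ) U₀)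
    (Y : PBond (F.P n) 0 → Matrix (Fin 2) (Fin 2) ℂ) : QTwS F n K h U₀ (HfOne F n K h c₀ cB a TJ U₀ Y) = Y :=
  QTwS_Hf hp Y

/-- ★ **(45)₂ FOR THE `h46tw`-TYPE READER OF `H₁`, `IsLandauPrintS` SHAPE: `R_S(D*_{U₀}(toL2 (HfOne Y))) = 0`.** [cite: Balaban1985Variational, (45) p.285; Balaban1985BackgroundPropagators, (3.110) p.417] -/
theorem landauS_HfOne {U₀ : GaugeField (F.P K) 0 (Matrix.specialUnitaryGroup (Fin 2) ℂ)} (hp : PosOnto F n K h c₀ cB a (DeltaOne F n K h c₀ cB a TJ) U₀)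
    (hq : PosPrime F n K h c₀ cB a U₀) (Y : PBond (F.P n) 0 → Matrix (Fin 2) (Fin 2) ℂ) :
    RS F n K h c₀ cB U₀ (DstarL2 F n K c₀ U₀ (toL2 F K c₀ (HfOne F n K h c₀ cB a TJ U₀ Y))) = 0 := by
  rw [Hf_apply, map_smul, LinearEquiv.apply_symm_apply, map_smul, map_smul, RS_DstarL2_HT hp (inner_DL2_DeltaOne_eq_zero hq), smul_zero]

variable [Fact (0 < (F.L : ℝ))] [Fact (0 < ((F.L : ℝ)⁻¹) ^ (K - n))]

/-- ★ **`h129` FOR `H₁f := H1fOne`: `QTwS U₀ (ι(H₁f B)) = η⁻¹ • B`.** [cite: Balaban1985Variational, (129) p.297, (103) p.293; Balaban1985BackgroundPropagators, (3.129) p.421] -/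
theorem QTwS_iota_H1fOne {U₀ : GaugeField (F.P K) 0 (Matrix.specialUnitaryGroup (Fin 2) ℂ)} (hp : PosOnto F n K h c₀ cB a (DeltaOne F n K h c₀ cB a TJ) U₀)
    (B : PBond (F.P n) 0 → Matrix (Fin 2) (Fin 2) ℂ) :
    QTwS F n K h U₀ (fun b : PBond (F.P K) 0 => JetSup.equiv _ _ _ (H1fOne F n K h c₀ cB a TJ U₀ B) (bondEquiv F K b)) = fun c => (((eta F n K : ℝ) : ℂ))⁻¹ • B c :=
  QTwS_iota_H1f hp B

/-- ★ **`h129L` FOR `H₁f := H1fOne`, `IsLandauPrintS` SHAPE: `R_S(D*_{U₀}(toL2 (ι(H₁f B)))) = 0`.** [cite: Balaban1985Variational, (129) p.297, (45) p.285; Balaban1985BackgroundPropagators, (3.124) p.420] -/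
theorem landauS_iota_H1fOne {U₀ : GaugeField (F.P K) 0 (Matrix.specialUnitaryGroup (Fin 2) ℂ)} (hp : PosOnto F n K h c₀ cB a (DeltaOne F n K h c₀ cB a TJ) U₀)
    (hq : PosPrime F n K h c₀ cB a U₀) (B : PBond (F.P n) 0 → Matrix (Fin 2) (Fin 2) ℂ) :
    RS F n K h c₀ cB U₀ (DstarL2 F n K c₀ U₀ (toL2 F K c₀
      (fun b : PBond (F.P K) 0 => JetSup.equiv _ _ _ (H1fOne F n K h c₀ cB a TJ U₀ B) (bondEquiv F K b)))) = 0 := by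
  rw [iota_H1f_eq, LinearEquiv.apply_symm_apply]
  exact RS_DstarL2_HT hp (inner_DL2_DeltaOne_eq_zero hq) _

/-- ★ **`h102` FOR `𝒢f := frakGfOne`: `QTwS U₀ (ι(𝒢f f)) = 0`.** [cite: Balaban1985Variational, (102) p.293, p.294; Balaban1985BackgroundPropagators, (3.147) p.425] -/
theorem QTwS_iota_frakGfOne {U₀ : GaugeField (F.P K) 0 (Matrix.specialUnitaryGroup (Fin 2) ℂ)} (hp : PosOnto F n K h c₀ cB a (DeltaOne F n K h c₀ cB a TJ) U₀)
    (hq : PosPrime F n K h c₀ cB a U₀) (f : NegSize (F.L : ℝ) (((F.L : ℝ)⁻¹) ^ (K - n)) (fun _ : Bond 3 (periodsT3 F K) => K - n) 3 (Matrix (Fin 2) (Fin 2) ℂ)) :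
    QTwS F n K h U₀ (fun b : PBond (F.P K) 0 => JetSup.equiv _ _ _ (frakGfOne F n K h c₀ cB a TJ U₀ f) (bondEquiv F K b)) = 0 :=
  QTwS_iota_frakGfR hp (DeltaOne_kills_NS hq) f

/-- ★ **`h102L` FOR `𝒢f := frakGfOne`, `IsLandauPrintS` SHAPE: `R_S(D*_{U₀}(toL2 (ι(𝒢f f)))) = 0`.** [cite: Balaban1985Variational, (102) p.293, p.294; Balaban1985BackgroundPropagators, (3.124) p.420] -/
theorem landauS_iota_frakGfOne {U₀ : GaugeField (F.P K) 0 (Matrix.specialUnitaryGroup (Fin 2) ℂ)} (hp : PosOnto F n K h c₀ cB a (DeltaOne F n K h c₀ cB a TJ) U₀)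
    (hq : PosPrime F n K h c₀ cB a U₀) (f : NegSize (F.L : ℝ) (((F.L : ℝ)⁻¹) ^ (K - n)) (fun _ : Bond 3 (periodsT3 F K) => K - n) 3 (Matrix (Fin 2) (Fin 2) ℂ)) :
    RS F n K h c₀ cB U₀ (DstarL2 F n K c₀ U₀ (toL2 F K c₀
      (fun b : PBond (F.P K) 0 => JetSup.equiv _ _ _ (frakGfOne F n K h c₀ cB a TJ U₀ f) (bondEquiv F K b)))) = 0 := by
  rw [iota_frakGfR_eq, LinearEquiv.apply_symm_apply]
  exact RS_DstarL2_frakGT hp (DeltaOne_kills_NS hq) (inner_DL2_DeltaOne_eq_zero hq) _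

/-! ## §4 (v1.1, append-only) `T_J := 0`: the `G₁`∕`H₁`∕`𝔊` letters ARE print's `G`∕`H`∕`𝔊` of (3.122)∕(3.126)∕(3.147) -/

omit [Fact (0 < (F.L : ℝ))] [Fact (0 < ((F.L : ℝ)⁻¹) ^ (K - n))] in
/-- **`G₁` AT `T_J = 0` IS PRINT'S `G` OF (3.122)** (`Δ₁ = Δ_π`, ✓`DeltaOne_zero`). [cite: Balaban1985BackgroundPropagators, (3.130) p.421] -/
theorem G1pi_zero : G1pi F n K h c₀ cB a (fun _ => 0) = Summit.QuantumFields.YangMills.Theorems.Prop7SectET3DeltaPi.Gpi F n K h c₀ cB a := by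
  funext U₀
  rw [G1pi, DeltaOne_zero]

omit [Fact (0 < (F.L : ℝ))] [Fact (0 < ((F.L : ℝ)⁻¹) ^ (K - n))] in
/-- **`(QG₁Q*)⁻¹` AT `T_J = 0` IS `(QGQ*)⁻¹`.** [cite: Balaban1985BackgroundPropagators, (3.126) p.420, (3.130) p.421] -/
theorem Kinv1pi_zero (U₀ : GaugeField (F.P K) 0 (Matrix.specialUnitaryGroup (Fin 2) ℂ)) :
    Kinv1pi F n K h c₀ cB a (fun _ => 0) U₀ = KinvT F n K h c₀ cB a (Summit.QuantumFields.YangMills.Theorems.Prop7SectET3DeltaPi.DeltaPiSlot F n K h c₀ cB a) U₀ := by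
  rw [Kinv1pi, DeltaOne_zero]

omit [Fact (0 < (F.L : ℝ))] [Fact (0 < ((F.L : ℝ)⁻¹) ^ (K - n))] in
/-- **`H₁` AT `T_J = 0` IS PRINT'S `H` OF (3.126).** [cite: Balaban1985BackgroundPropagators, (3.126) p.420, (3.129)–(3.130) p.421] -/
theorem H1pi_zero : H1pi F n K h c₀ cB a (fun _ => 0) = Summit.QuantumFields.YangMills.Theorems.Prop7SectET3DeltaPi.Hpi F n K h c₀ cB a := by
  funext U₀
  rw [H1pi, DeltaOne_zero]

omit [Fact (0 < (F.L : ℝ))] [Fact (0 < ((F.L : ℝ)⁻¹) ^ (K - n))] in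
/-- **`𝔊` AT `T_J = 0` IS `G𝔓*` WITH PRINT'S `G`.** [cite: Balaban1985BackgroundPropagators, (3.147) p.425, (3.130) p.421] -/
theorem frakG1pi_zero (U₀ : GaugeField (F.P K) 0 (Matrix.specialUnitaryGroup (Fin 2) ℂ)) :
    frakG1pi F n K h c₀ cB a (fun _ => 0) U₀ = frakGT F n K h c₀ cB a (Summit.QuantumFields.YangMills.Theorems.Prop7SectET3DeltaPi.DeltaPiSlot F n K h c₀ cB a) U₀ := by
  rw [frakG1pi, DeltaOne_zero]

omit [Fact (0 < (F.L : ℝ))] [Fact (0 < ((F.L : ℝ)⁻¹) ^ (K - n))] in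
/-- **THE `h46tw`-TYPE READER AT `T_J = 0` IS THE LETTER OF RECORD `H46`.** [cite: Balaban1985Variational, (45)–(46) p.285; Balaban1985BackgroundPropagators, (3.130) p.421] -/
theorem HfOne_zero (U₀ : GaugeField (F.P K) 0 (Matrix.specialUnitaryGroup (Fin 2) ℂ)) :
    HfOne F n K h c₀ cB a (fun _ => 0) U₀ = Summit.QuantumFields.YangMills.Theorems.Prop7SectET3DeltaPi.H46 F n K h c₀ cB a U₀ := by
  rw [HfOne, DeltaOne_zero]

/-- **THE EX LETTER `H₁f` AT `T_J = 0` IS `H1f … DeltaPiSlot`.** [cite: Balaban1985Variational, (103) p.293; Balaban1985BackgroundPropagators, (3.130) p.421] -/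
theorem H1fOne_zero (U₀ : GaugeField (F.P K) 0 (Matrix.specialUnitaryGroup (Fin 2) ℂ)) :
    H1fOne F n K h c₀ cB a (fun _ => 0) U₀ = H1f F n K h c₀ cB a (Summit.QuantumFields.YangMills.Theorems.Prop7SectET3DeltaPi.DeltaPiSlot F n K h c₀ cB a) U₀ := by
  rw [H1fOne, DeltaOne_zero]

/-- **THE EX LETTER `𝒢f` AT `T_J = 0` IS `frakGfR … DeltaPiSlot`.** [cite: Balaban1985Variational, (111) p.294; Balaban1985BackgroundPropagators, (3.130) p.421] -/
theorem frakGfOne_zero (U₀ : GaugeField (F.P K) 0 (Matrix.specialUnitaryGroup (Fin 2) ℂ)) :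
    frakGfOne F n K h c₀ cB a (fun _ => 0) U₀ = frakGfR F n K h c₀ cB a (Summit.QuantumFields.YangMills.Theorems.Prop7SectET3DeltaPi.DeltaPiSlot F n K h c₀ cB a) U₀ := by
  rw [frakGfOne, DeltaOne_zero]

end Summit.QuantumFields.YangMills.Theorems.Prop7SectET3DeltaOne

end
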